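import Summits.BirchSwinnertonDyer.BirchSwinnertonDyer.Theorems.CyclotomicUntwistGammaLeadingTerm
import HarnessLib

/-!
# One-sided main-conjecture shapes transfer one-sidedly: a divisibility in `Λ_𝓞` (up to `p^e`) gives an
# inequality of orders at `𝟙` and of leading-term valuations — the LOWER-half (Wan) and UPPER-half
# (Kato) shapes for the cruxes K1/K2 of route `CyclotomicUntwist`

Cell `pub/bsd-wall` (D-0145 line `route-BirchSwinnertonDyer-CyclotomicUntwist`), seat `bsd-line-cycu-p1`
(prover seat 1/3), helper toward crux K1 `PSRankOneLowerHalfAtThree` (stmt-BirchSwinnertonDyer-21580;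
mirror use: K2 `PSRankOneUpperHalfAtThree`, stmt-…-21581). THEOREMS ONLY (no definition, no named fact,
no `sorry`). BSD is not proved by this file and no crux of the route is proved by it; every
main-conjecture statement below is a HYPOTHESIS written as an explicit convolution identity (no new
predicate is introduced): `char = 3^e · (w ⋆ 𝓛)` ("`𝓛 ∣ char` in `𝓗`", the `⊇`/Wan direction the LOWER
half of BSD₃ needs) or `3^e · 𝓛 = w ⋆ char` ("`char ∣ 𝓛`", the `⊆`/Kato direction the UPPER half needs),
with `w ∈ Λ_𝓞` (`IsIwasawaIntegral`, additive) — half of D3's two-sided `IsNormalisedFor`/`IsUnitMultipleOf`.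

CONTENT (general `p` in §1–§2, `p = 3` in §3):
* §1 `norm_gammaMahlerCoeff_le_one` — a `Λ_𝓞`-integral additive system has Amice transform in `𝓞⟦T⟧`
  (Mahler coefficients, hence the leading coefficient, of norm `≤ 1`);
* §2 `gammaOrderAtOne_gammaConv_of_isIwasawaIntegral` (`ord_𝟙(w ⋆ μ) = ord_𝟙(w) + ord_𝟙(μ)`),
  `gammaLeadingCoeff_gammaConv_of_isIwasawaIntegral` (`lead_𝟙(w ⋆ μ) = lead_𝟙(w)·lead_𝟙(μ)`, via Mathlib
  `PowerSeries.divXPowOrder_mul`), hence `gammaOrderAtOne_le_gammaConv` and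
  `norm_gammaLeadingCoeff_gammaConv_le` (`ord_𝟙(μ) ≤ ord_𝟙(w ⋆ μ)`, `‖lead_𝟙(w ⋆ μ)‖ ≤ ‖lead_𝟙(μ)‖`);
* §3 for `D : PSFiniteSlopeSelmerData W η α` and `𝓛` additive of order `≤ ½` (D1):
  LOWER shape `orderAtOne_ge_and_norm_leadingCoeffAtOne_le_of_eq_smul_gammaConv`
  (`ord_𝟙(𝓛) ≤ D.orderAtOne`, `‖D.leadingCoeffAtOne‖ ≤ 3^{-e}‖lead_𝟙(𝓛)‖`) and its rank-one form
  `rankOne_lower_of_eq_smul_gammaConv` (with `D.HasExactOrderAtOne`, `selmerRank = 1`, `𝓛(𝟙) = 0`: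
  **`ord_𝟙(𝓛) = 1`, `c₁(𝓛) ≠ 0`** — the analytic order and the non-vanishing of `𝓛′(𝟙)` are FORCED, so
  under GZ₃ the `ψ`-line height is non-degenerate — and `‖lead_𝟙(char)‖ ≤ 3^{-e}‖c₁(𝓛)‖`);
  UPPER shape `orderAtOne_le_and_norm_leadingCoeffAtOne_ge_of_smul_eq_gammaConv`
  (`D.orderAtOne ≤ ord_𝟙(𝓛)`, `3^{-e}‖lead_𝟙(𝓛)‖ ≤ ‖D.leadingCoeffAtOne‖`) and its rank-one form
  `rankOne_upper_of_smul_eq_gammaConv` (with the control inequality, `selmerRank = 1`, `𝓛(𝟙) = 0`,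
  `c₁(𝓛) ≠ 0`: **`D.HasExactOrderAtOne`** is FORCED and `3^{-e}‖c₁(𝓛)‖ ≤ ‖lead_𝟙(char)‖`).
So in the rank-one reading each half of BSD₃ needs only ITS divisibility, and the "exact order" /
"non-degenerate height" inputs are consequences, not extra hypotheses, on the respective sides.

References: [cite: Benois2014, §0.4 (ii), Remarks 1 and 4; §4.2 Prop. 12] · [cite: PerrinRiou1993AIF, Introduction]
· [cite: Bellaiche2021, §6.3.5 and Exercise 6.3.10] · [cite: MazurTateTeitelbaum1986Invent, §I.13].
-/

noncomputable section

open Filter Topology Finset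
open Literature.NumberTheory.EllipticCurves Literature.NumberTheory.IwasawaTheory
open Summit.BirchSwinnertonDyer.BirchSwinnertonDyer.Theorems.PSGammaConvolution
open Summit.BirchSwinnertonDyer.BirchSwinnertonDyer.Theorems.PSGammaLeadingTerm

-- single-conjunct summit: `Summit.BirchSwinnertonDyer.BirchSwinnertonDyer.…` repeats the name by design
set_option linter.dupNamespace false

namespace Summit.BirchSwinnertonDyer.BirchSwinnertonDyer.Theorems.PSGammaDivisibility

variable {p : ℕ} [Fact p.Prime]

/-! ### §1 Integral systems have integral Mahler coefficients -/

/-- The Riemann sums of `binom(·, k)` against a `Λ_𝓞`-integral system have norm `≤ 1`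
(binomial coefficients are integers; ultrametric inequality). [cite: Bellaiche2021, §6.3.5 and Exercise 6.3.10] -/
theorem norm_gammaRiemannSum_choose_le_one {w : (n : ℕ) → ZMod (p ^ n) → ℂ_[p]}
    (hw : IsIwasawaIntegral p w) (k n : ℕ) :
    ‖gammaRiemannSum p w (fun a ↦ ((a.choose k : ℕ) : ℂ_[p])) n‖ ≤ 1 := by
  rw [gammaRiemannSum_def]
  refine IsUltrametricDist.norm_sum_le_of_forall_le_of_nonneg zero_le_one fun s _ ↦ ?_
  rw [norm_mul]
  exact mul_le_one₀ (norm_natCast_padicComplex_le_one _) (norm_nonneg _) (hw n s)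

/-- **A `Λ_𝓞`-integral additive system has Mahler coefficients of norm `≤ 1`** (its Amice transform lies
in `𝓞⟦T⟧`). [cite: Bellaiche2021, §6.3.5 and Exercise 6.3.10] [cite: MazurTateTeitelbaum1986Invent, §I.13] -/
theorem norm_gammaMahlerCoeff_le_one {w : (n : ℕ) → ZMod (p ^ n) → ℂ_[p]}
    (hw : IsGammaDistribution p w) (hw' : IsIwasawaIntegral p w) (k : ℕ) :
    ‖gammaMahlerCoeff p w k‖ ≤ 1 :=
  le_of_tendsto' ((tendsto_gammaRiemannSum_gammaMahlerCoeff hw hw'.hasGrowthOrder_zero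
    zero_lt_one k).norm) fun n ↦ norm_gammaRiemannSum_choose_le_one hw' k n

/-- Every coefficient of the Amice transform of a `Λ_𝓞`-integral additive system has norm `≤ 1`.
[cite: Bellaiche2021, §6.3.5] -/
theorem norm_coeff_gammaAmiceTransform_le_one {w : (n : ℕ) → ZMod (p ^ n) → ℂ_[p]}
    (hw : IsGammaDistribution p w) (hw' : IsIwasawaIntegral p w) (k : ℕ) :
    ‖PowerSeries.coeff k (gammaAmiceTransform p w)‖ ≤ 1 := by
  rw [coeff_gammaAmiceTransform]
  exact norm_gammaMahlerCoeff_le_one hw hw' k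

/-- The leading coefficient at `𝟙` of a `Λ_𝓞`-integral additive system has norm `≤ 1`.
[cite: Bellaiche2021, §6.3.5] -/
theorem norm_gammaLeadingCoeff_le_one {w : (n : ℕ) → ZMod (p ^ n) → ℂ_[p]}
    (hw : IsGammaDistribution p w) (hw' : IsIwasawaIntegral p w) :
    ‖gammaLeadingCoeff p w‖ ≤ 1 := by
  rw [gammaLeadingCoeff_def]
  exact norm_coeff_gammaAmiceTransform_le_one hw hw' _

/-! ### §2 Order and leading coefficient of a `Λ`-product -/

/-- The leading coefficient at `𝟙` is the constant term of the Amice transform divided by `T^{ord}`.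
[cite: MazurTateTeitelbaum1986Invent, §I.13] -/
theorem gammaLeadingCoeff_eq_constantCoeff_divXPowOrder (μ : (n : ℕ) → ZMod (p ^ n) → ℂ_[p]) :
    gammaLeadingCoeff p μ = PowerSeries.constantCoeff (PowerSeries.divXPowOrder (gammaAmiceTransform p μ)) := by
  rw [gammaLeadingCoeff_def, gammaOrderAtOne_def, PowerSeries.constantCoeff_divXPowOrder]

/-- **Orders at `𝟙` add under convolution with an integral system**: `ord_𝟙(w ⋆ μ) = ord_𝟙(w) + ord_𝟙(μ)`
for `w ∈ Λ_𝓞` additive and `μ` additive of order `ν ∈ [0,1)` (`ℂ_p⟦T⟧` is a domain).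
[cite: Bellaiche2021, §6.3.5] [cite: Benois2014, §0.4 Remark 1] -/
theorem gammaOrderAtOne_gammaConv_of_isIwasawaIntegral {ν : ℝ} {w μ : (n : ℕ) → ZMod (p ^ n) → ℂ_[p]}
    (hw : IsGammaDistribution p w) (hw' : IsIwasawaIntegral p w) (hμ : IsGammaDistribution p μ)
    (hμ' : HasGrowthOrder p ν μ) (hν : 0 ≤ ν) (hν1 : ν < 1) :
    gammaOrderAtOne p (gammaConv p w μ) = gammaOrderAtOne p w + gammaOrderAtOne p μ := by
  rw [gammaOrderAtOne_def, gammaOrderAtOne_def, gammaOrderAtOne_def,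
    gammaAmiceTransform_gammaConv hw hμ hw'.hasGrowthOrder_zero hμ' le_rfl hν (by simpa using hν1),
    PowerSeries.order_mul]

/-- **Leading coefficients at `𝟙` multiply under convolution with an integral system**:
`lead_𝟙(w ⋆ μ) = lead_𝟙(w) · lead_𝟙(μ)`. [cite: Bellaiche2021, §6.3.5] [cite: Benois2014, §0.4 Remark 1] -/
theorem gammaLeadingCoeff_gammaConv_of_isIwasawaIntegral {ν : ℝ} {w μ : (n : ℕ) → ZMod (p ^ n) → ℂ_[p]}
    (hw : IsGammaDistribution p w) (hw' : IsIwasawaIntegral p w) (hμ : IsGammaDistribution p μ)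
    (hμ' : HasGrowthOrder p ν μ) (hν : 0 ≤ ν) (hν1 : ν < 1) :
    gammaLeadingCoeff p (gammaConv p w μ) = gammaLeadingCoeff p w * gammaLeadingCoeff p μ := by
  rw [gammaLeadingCoeff_eq_constantCoeff_divXPowOrder, gammaLeadingCoeff_eq_constantCoeff_divXPowOrder,
    gammaLeadingCoeff_eq_constantCoeff_divXPowOrder,
    gammaAmiceTransform_gammaConv hw hμ hw'.hasGrowthOrder_zero hμ' le_rfl hν (by simpa using hν1),
    PowerSeries.divXPowOrder_mul, map_mul]

/-- **Divisibility bounds the order below**: `ord_𝟙(μ) ≤ ord_𝟙(w ⋆ μ)` for `w ∈ Λ_𝓞`.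
[cite: Benois2014, §0.4 Remark 1] -/
theorem gammaOrderAtOne_le_gammaConv {ν : ℝ} {w μ : (n : ℕ) → ZMod (p ^ n) → ℂ_[p]}
    (hw : IsGammaDistribution p w) (hw' : IsIwasawaIntegral p w) (hμ : IsGammaDistribution p μ)
    (hμ' : HasGrowthOrder p ν μ) (hν : 0 ≤ ν) (hν1 : ν < 1) :
    gammaOrderAtOne p μ ≤ gammaOrderAtOne p (gammaConv p w μ) := by
  rw [gammaOrderAtOne_gammaConv_of_isIwasawaIntegral hw hw' hμ hμ' hν hν1]
  exact le_add_self

/-- **Divisibility bounds the leading term**: `‖lead_𝟙(w ⋆ μ)‖ ≤ ‖lead_𝟙(μ)‖` for `w ∈ Λ_𝓞`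
(`‖lead_𝟙(w)‖ ≤ 1`). [cite: Benois2014, §0.4 Remark 1] [cite: Bellaiche2021, §6.3.5] -/
theorem norm_gammaLeadingCoeff_gammaConv_le {ν : ℝ} {w μ : (n : ℕ) → ZMod (p ^ n) → ℂ_[p]}
    (hw : IsGammaDistribution p w) (hw' : IsIwasawaIntegral p w) (hμ : IsGammaDistribution p μ)
    (hμ' : HasGrowthOrder p ν μ) (hν : 0 ≤ ν) (hν1 : ν < 1) :
    ‖gammaLeadingCoeff p (gammaConv p w μ)‖ ≤ ‖gammaLeadingCoeff p μ‖ := by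
  rw [gammaLeadingCoeff_gammaConv_of_isIwasawaIntegral hw hw' hμ hμ' hν hν1, norm_mul]
  exact mul_le_of_le_one_left (norm_nonneg _) (norm_gammaLeadingCoeff_le_one hw hw')

/-- If `ord_𝟙(w ⋆ μ) = ord_𝟙(μ) < ∞` then `w` does not vanish at `𝟙` (`ord_𝟙(w) = 0`).
[cite: Benois2014, §0.4 Remark 1] -/
theorem gammaOrderAtOne_eq_zero_of_gammaConv_eq {ν : ℝ} {w μ : (n : ℕ) → ZMod (p ^ n) → ℂ_[p]}
    (hw : IsGammaDistribution p w) (hw' : IsIwasawaIntegral p w) (hμ : IsGammaDistribution p μ)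
    (hμ' : HasGrowthOrder p ν μ) (hν : 0 ≤ ν) (hν1 : ν < 1)
    (h : gammaOrderAtOne p (gammaConv p w μ) = gammaOrderAtOne p μ) (hfin : gammaOrderAtOne p μ ≠ ⊤) :
    gammaOrderAtOne p w = 0 := by
  rw [gammaOrderAtOne_gammaConv_of_isIwasawaIntegral hw hw' hμ hμ' hν hν1] at h
  obtain ⟨m, hm⟩ := ENat.ne_top_iff_exists.mp hfin
  rw [← hm] at h
  have hw_fin : gammaOrderAtOne p w ≠ ⊤ := by
    intro ht; rw [ht, top_add] at h; exact ENat.top_ne_coe _ h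
  obtain ⟨a, ha⟩ := ENat.ne_top_iff_exists.mp hw_fin
  rw [← ha, ← ENat.coe_add, ENat.coe_inj] at h
  rw [← ha]
  norm_cast
  omega

/-! ### §3 `p = 3`: one-sided shapes of IMC₃ for a datum `D : PSFiniteSlopeSelmerData W η α` -/

section Three

variable {W : WeierstrassCurve ℚ} {η : DirichletCharacter ℂ_[3] (3 ^ 2)} {α : ℂ_[3]}
  (D : PSFiniteSlopeSelmerData W η α) {𝓛 w : (n : ℕ) → ZMod (3 ^ n) → ℂ_[3]} {e : ℤ}

/-- **LOWER-HALF SHAPE (`𝓛 ∣ char` in `𝓗`, the Wan direction): order inequality and leading-term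
bound.** If `char = 3^e · (w ⋆ 𝓛)` with `w ∈ Λ_𝓞` additive and `𝓛` additive of order `≤ ½`, then
`ord_𝟙(𝓛) ≤ ord_𝟙(char)` and `‖lead_𝟙(char)‖ ≤ 3^{-e} · ‖lead_𝟙(𝓛)‖`.
[cite: Benois2014, §0.4 (ii) and Remark 1] [cite: PerrinRiou1993AIF, Introduction] -/
theorem orderAtOne_ge_and_norm_leadingCoeffAtOne_le_of_eq_smul_gammaConv
    (hw : IsGammaDistribution 3 w) (hw' : IsIwasawaIntegral 3 w) (h𝓛 : IsGammaDistribution 3 𝓛)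
    (h𝓛' : HasGrowthOrder 3 (1 / 2) 𝓛)
    (hchar : ∀ (n : ℕ) (s : ZMod (3 ^ n)), D.charElt n s = (3 : ℂ_[3]) ^ e * gammaConv 3 w 𝓛 n s) :
    gammaOrderAtOne 3 𝓛 ≤ D.orderAtOne ∧
      ‖D.leadingCoeffAtOne‖ ≤ (3 : ℝ) ^ (-e) * ‖gammaLeadingCoeff 3 𝓛‖ := by
  have hD : D.charElt = fun n s ↦ (3 : ℂ_[3]) ^ e * gammaConv 3 w 𝓛 n s :=
    funext fun n ↦ funext fun s ↦ hchar n s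
  have hc : ((3 : ℂ_[3]) ^ e) ≠ 0 := zpow_ne_zero _ (by norm_num)
  have hX : IsGammaDistribution 3 (gammaConv 3 w 𝓛) := isGammaDistribution_gammaConv hw h𝓛
  have hX' : HasGrowthOrder 3 (0 + 1 / 2) (gammaConv 3 w 𝓛) :=
    hasGrowthOrder_gammaConv hw'.hasGrowthOrder_zero h𝓛'
  have h3 : ‖(3 : ℂ_[3]) ^ e‖ = (3 : ℝ) ^ (-e) := by
    have : ‖((3 : ℕ) : ℂ_[3])‖ = ((3 : ℕ) : ℝ)⁻¹ := by
      rw [← map_natCast (algebraMap ℚ_[3] ℂ_[3]) 3, norm_algebraMap', Padic.norm_p]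
    rw [norm_zpow, show (3 : ℂ_[3]) = ((3 : ℕ) : ℂ_[3]) by norm_cast, this]
    push_cast
    rw [inv_zpow']
  refine ⟨?_, ?_⟩
  · rw [PSFiniteSlopeSelmerData.orderAtOne, hD, gammaOrderAtOne_smul hc hX hX' (by norm_num)]
    exact gammaOrderAtOne_le_gammaConv hw hw' h𝓛 h𝓛' (by norm_num) (by norm_num)
  · rw [PSFiniteSlopeSelmerData.leadingCoeffAtOne, hD, gammaLeadingCoeff_smul hc hX hX' (by norm_num),
      norm_mul, h3]
    exact mul_le_mul_of_nonneg_left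
      (norm_gammaLeadingCoeff_gammaConv_le hw hw' h𝓛 h𝓛' (by norm_num) (by norm_num))
      (zpow_nonneg (by norm_num) _)

/-- **LOWER-HALF SHAPE, rank one.** If moreover `char` vanishes at `𝟙` to order exactly `selmerRank = 1`
and `𝓛(𝟙) = c₀(𝓛) = 0` (the interpolated vanishing `L(E,1) = 0`), then `ord_𝟙(𝓛) = 1`,
`𝓛′(𝟙) = c₁(𝓛) ≠ 0` — the ANALYTIC order is forced to be exactly one, so with GZ₃ the `ψ`-line height is
non-degenerate — and `‖lead_𝟙(char)‖ ≤ 3^{-e} · ‖c₁(𝓛)‖` (the inequality the lower half of BSD₃ reads).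
[cite: Benois2014, §0.4 (ii), §4.2 Prop. 12] [cite: PerrinRiou1993AIF, Introduction] -/
theorem rankOne_lower_of_eq_smul_gammaConv
    (hw : IsGammaDistribution 3 w) (hw' : IsIwasawaIntegral 3 w) (h𝓛 : IsGammaDistribution 3 𝓛)
    (h𝓛' : HasGrowthOrder 3 (1 / 2) 𝓛)
    (hchar : ∀ (n : ℕ) (s : ZMod (3 ^ n)), D.charElt n s = (3 : ℂ_[3]) ^ e * gammaConv 3 w 𝓛 n s)
    (hex : D.HasExactOrderAtOne) (hr : D.selmerRank = 1) (h0 : gammaMahlerCoeff 3 𝓛 0 = 0) :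
    gammaOrderAtOne 3 𝓛 = 1 ∧ gammaMahlerCoeff 3 𝓛 1 ≠ 0 ∧
      ‖D.leadingCoeffAtOne‖ ≤ (3 : ℝ) ^ (-e) * ‖gammaMahlerCoeff 3 𝓛 1‖ := by
  obtain ⟨hle, hlead⟩ :=
    orderAtOne_ge_and_norm_leadingCoeffAtOne_le_of_eq_smul_gammaConv D hw hw' h𝓛 h𝓛' hchar
  have hD1 : D.orderAtOne = 1 := by rw [hex, hr, Nat.cast_one]
  rw [hD1] at hle
  -- `c₀ = 0` gives `ord ≥ 1`, so `ord = 1`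
  have hge : (1 : ℕ∞) ≤ gammaOrderAtOne 3 𝓛 := by
    rw [gammaOrderAtOne_def]
    refine PowerSeries.nat_le_order _ 1 fun i hi ↦ ?_
    have : i = 0 := by omega
    subst this
    rw [coeff_gammaAmiceTransform, h0]
  have hord : gammaOrderAtOne 3 𝓛 = 1 := le_antisymm hle hge
  have h1 := PowerSeries.order_eq_nat.mp
    (by rw [gammaOrderAtOne_def] at hord; exact_mod_cast hord : (gammaAmiceTransform 3 𝓛).order = (1 : ℕ))
  have hlead1 : gammaLeadingCoeff 3 𝓛 = gammaMahlerCoeff 3 𝓛 1 := by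
    rw [gammaLeadingCoeff_def, hord, coeff_gammaAmiceTransform]
    rfl
  refine ⟨hord, ?_, ?_⟩
  · have := h1.1
    rwa [coeff_gammaAmiceTransform] at this
  · rwa [hlead1] at hlead

/-- **UPPER-HALF SHAPE (`char ∣ 𝓛` in `𝓗`, the Kato direction): order inequality and leading-term
bound.** If `3^e · 𝓛 = w ⋆ char` with `w ∈ Λ_𝓞` additive and `𝓛` additive of order `≤ ½`, then
`ord_𝟙(char) ≤ ord_𝟙(𝓛)` and `3^{-e} · ‖lead_𝟙(𝓛)‖ ≤ ‖lead_𝟙(char)‖`.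
[cite: Benois2014, §0.4 Remark 4] [cite: PerrinRiou1993AIF, Introduction] -/
theorem orderAtOne_le_and_norm_leadingCoeffAtOne_ge_of_smul_eq_gammaConv
    (hw : IsGammaDistribution 3 w) (hw' : IsIwasawaIntegral 3 w) (h𝓛 : IsGammaDistribution 3 𝓛)
    (h𝓛' : HasGrowthOrder 3 (1 / 2) 𝓛)
    (hdiv : ∀ (n : ℕ) (s : ZMod (3 ^ n)), (3 : ℂ_[3]) ^ e * 𝓛 n s = gammaConv 3 w D.charElt n s) :
    D.orderAtOne ≤ gammaOrderAtOne 3 𝓛 ∧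
      (3 : ℝ) ^ (-e) * ‖gammaLeadingCoeff 3 𝓛‖ ≤ ‖D.leadingCoeffAtOne‖ := by
  have hEq : (fun n s ↦ (3 : ℂ_[3]) ^ e * 𝓛 n s) = gammaConv 3 w D.charElt :=
    funext fun n ↦ funext fun s ↦ hdiv n s
  have hc : ((3 : ℂ_[3]) ^ e) ≠ 0 := zpow_ne_zero _ (by norm_num)
  have h3 : ‖(3 : ℂ_[3]) ^ e‖ = (3 : ℝ) ^ (-e) := by
    have : ‖((3 : ℕ) : ℂ_[3])‖ = ((3 : ℕ) : ℝ)⁻¹ := by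
      rw [← map_natCast (algebraMap ℚ_[3] ℂ_[3]) 3, norm_algebraMap', Padic.norm_p]
    rw [norm_zpow, show (3 : ℂ_[3]) = ((3 : ℕ) : ℂ_[3]) by norm_cast, this]
    push_cast
    rw [inv_zpow']
  have hord : gammaOrderAtOne 3 𝓛 = gammaOrderAtOne 3 (gammaConv 3 w D.charElt) := by
    rw [← hEq, gammaOrderAtOne_smul hc h𝓛 h𝓛' (by norm_num)]
  have hlead : (3 : ℂ_[3]) ^ e * gammaLeadingCoeff 3 𝓛 = gammaLeadingCoeff 3 (gammaConv 3 w D.charElt) := by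
    rw [← hEq, gammaLeadingCoeff_smul hc h𝓛 h𝓛' (by norm_num)]
  refine ⟨?_, ?_⟩
  · rw [PSFiniteSlopeSelmerData.orderAtOne, hord]
    exact gammaOrderAtOne_le_gammaConv hw hw' D.isGammaDistribution_charElt D.hasGrowthOrder_charElt
      (by norm_num) (by norm_num)
  · rw [PSFiniteSlopeSelmerData.leadingCoeffAtOne, ← h3, ← norm_mul, hlead]
    exact norm_gammaLeadingCoeff_gammaConv_le hw hw' D.isGammaDistribution_charElt
      D.hasGrowthOrder_charElt (by norm_num) (by norm_num)

/-- **UPPER-HALF SHAPE, rank one.** If moreover `selmerRank = 1 ≤ ord_𝟙(char)` (the control inequality)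
and `𝓛(𝟙) = 0`, `𝓛′(𝟙) = c₁(𝓛) ≠ 0` (GZ₃ with a non-degenerate `ψ`-line height), then the ALGEBRAIC
order is forced to be exactly one (`D.HasExactOrderAtOne`) and `3^{-e} · ‖c₁(𝓛)‖ ≤ ‖lead_𝟙(char)‖`
(the inequality the upper half of BSD₃ reads). [cite: Benois2014, §0.4 Remark 4; §4.2 Prop. 12] [cite: PerrinRiou1993AIF, Introduction] -/
theorem rankOne_upper_of_smul_eq_gammaConv
    (hw : IsGammaDistribution 3 w) (hw' : IsIwasawaIntegral 3 w) (h𝓛 : IsGammaDistribution 3 𝓛)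
    (h𝓛' : HasGrowthOrder 3 (1 / 2) 𝓛)
    (hdiv : ∀ (n : ℕ) (s : ZMod (3 ^ n)), (3 : ℂ_[3]) ^ e * 𝓛 n s = gammaConv 3 w D.charElt n s)
    (hctl : D.HasControlInequality) (hr : D.selmerRank = 1)
    (h0 : gammaMahlerCoeff 3 𝓛 0 = 0) (h1 : gammaMahlerCoeff 3 𝓛 1 ≠ 0) :
    D.HasExactOrderAtOne ∧ (3 : ℝ) ^ (-e) * ‖gammaMahlerCoeff 3 𝓛 1‖ ≤ ‖D.leadingCoeffAtOne‖ := by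
  obtain ⟨hle, hlead⟩ :=
    orderAtOne_le_and_norm_leadingCoeffAtOne_ge_of_smul_eq_gammaConv D hw hw' h𝓛 h𝓛' hdiv
  have hord : gammaOrderAtOne 3 𝓛 = 1 := by
    rw [gammaOrderAtOne_def, ← Nat.cast_one, PowerSeries.order_eq_nat]
    refine ⟨by rwa [coeff_gammaAmiceTransform], fun i hi ↦ ?_⟩
    have : i = 0 := by omega
    subst this
    rw [coeff_gammaAmiceTransform, h0]
  rw [hord] at hle
  have hge : (1 : ℕ∞) ≤ D.orderAtOne := by
    have := hctl
    rw [PSFiniteSlopeSelmerData.hasControlInequality_iff, hr, Nat.cast_one] at this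
    exact this
  have hex : D.HasExactOrderAtOne := by
    rw [PSFiniteSlopeSelmerData.hasExactOrderAtOne_iff, hr, Nat.cast_one]
    exact le_antisymm hle hge
  have hlead1 : gammaLeadingCoeff 3 𝓛 = gammaMahlerCoeff 3 𝓛 1 := by
    rw [gammaLeadingCoeff_def, hord, coeff_gammaAmiceTransform]
    rfl
  exact ⟨hex, by rwa [hlead1] at hlead⟩

end Three

end Summit.BirchSwinnertonDyer.BirchSwinnertonDyer.Theorems.PSGammaDivisibility

end
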